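import Mathlib
import Literature.NumberTheory.Transcendental.SchanuelEclEmptyProofs
import Literature.ModelTheory.ExponentialFields.ExponentialField
import Summits.Schanuel.Schanuel.Theses.RootDecomp1C
import Summits.Schanuel.Schanuel.Theorems.RootDecomp1CAxisReductionNormalForm

/-!
# Conjugation symmetrisation: the support `AxisReduction` (stmt-Schanuel-24788) of routes RootDecomp1C / RootDecomp1G

`AxisReduction := AxisSchanuel → Schanuel`: Schanuel's conjecture follows from its restriction to AXIS tuples
(every coordinate real or purely imaginary). Proof = σ-symmetrisation (lens 6, node «ConjugationCarving»,
critic VERDICT 2026-08-30T01:40:14Z «landable NOW as a Theorems file»): a conjugation-stable finite-dimensional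
`ℚ`-subspace of `ℂ` is spanned by a `ℚ`-free axis tuple (`exists_axis_tuple_of_conj_stable`, part 1 =
`Theorems/RootDecomp1CAxisReductionNormalForm.lean`); for a `ℚ`-free
`z` symmetrise `V = span z` to `V + conj V`, use modularity of `dim_ℚ`, submodularity of `trdeg` and
`cexp ∘ conj = conj ∘ cexp` (`schanuel_of_axisSchanuel`). Port by the census seat of the lens file
`HOME/decomp-schanuel-lens-6/ConjugationSymmetrisation.lean` (the node's own `AxisSchanuel` def dropped in favour
of the route decl; the tower equality is a local step — the file imports no other Theorems module, per the theses-cone lint).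
0 sorry.
-/

set_option linter.dupNamespace false



namespace Summit.Schanuel.Schanuel.Theorems.RootDecomp1CAxisReduction

open Complex IntermediateField
open scoped ComplexConjugate
open Summit.Schanuel.Schanuel.Theses.RootDecomp1C

/-! ## The EQUIV layer: Schanuel for axis tuples implies Schanuel (symmetrise by `z ↦ conj z`,
submodularity of `trdeg`, modularity of `dim_ℚ`) -/

set_option synthInstance.maxHeartbeats 400000 in
/-- σ-symmetrisation: Schanuel for AXIS tuples implies Schanuel for all tuples. -/
theorem schanuel_of_axisSchanuel (hA : AxisSchanuel) : _root_.Schanuel := by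
  classical
  show ∀ (n : ℕ) (x : Fin n → ℂ), LinearIndependent ℚ x →
      (n : Cardinal) ≤ Algebra.trdeg ℚ
        ↥(IntermediateField.adjoin ℚ (Set.range x ∪ Set.range (cexp ∘ x)))
  intro n x hx
  -- tower equality `trdeg K(S) + trdeg_{K(S)} K(S)(T) = trdeg K(S ∪ T)` (Mathlib `trdeg_add_eq` + `adjoin_adjoin_left`),
  -- stated generically and instantiated at `K := ℚ` below (a `ℚ`-specialised statement hits the
  -- `IntermediateField.algebra` / `DivisionRing.toRatAlgebra` diamond)
  have tower : ∀ {K E : Type} [Field K] [Field E] [Algebra K E] (S T : Set E),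
      Algebra.trdeg K ↥(adjoin K S) + Algebra.trdeg ↥(adjoin K S) ↥(adjoin (↥(adjoin K S)) T) =
        Algebra.trdeg K ↥(adjoin K (S ∪ T)) := by
    intro K E _ _ _ S T
    haveI : FaithfulSMul (adjoin K S) (adjoin (adjoin K S) T) :=
      ⟨fun {m₁ m₂} h => (algebraMap (adjoin K S) (adjoin (adjoin K S) T)).injective
        (by simpa [Algebra.smul_def] using h 1)⟩
    have htower := trdeg_add_eq K (adjoin K S) (A := adjoin (adjoin K S) T)
    have heq : Algebra.trdeg K (adjoin (adjoin K S) T) = Algebra.trdeg K (adjoin K (S ∪ T)) := by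
      rw [← (equivOfEq (adjoin_adjoin_left K S T)).trdeg_eq]
      rfl
    rw [htower, heq]
  -- complex conjugation as a `ℚ`-algebra map, and the conjugate tuple
  let σ : ℂ →ₐ[ℚ] ℂ := (starRingEnd ℂ).toRatAlgHom
  have σ_apply : ∀ z, σ z = conj z := fun z => rfl
  let xc : Fin n → ℂ := fun j => conj (x j)
  have hxc : LinearIndependent ℚ xc :=
    hx.map' σ.toLinearMap (LinearMap.ker_eq_bot.mpr (starRingEnd ℂ).injective)
  set V : Submodule ℚ ℂ := Submodule.span ℚ (Set.range x) with hV
  set Vc : Submodule ℚ ℂ := Submodule.span ℚ (Set.range xc) with hVc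
  haveI : FiniteDimensional ℚ V := FiniteDimensional.span_of_finite ℚ (Set.finite_range x)
  haveI : FiniteDimensional ℚ Vc := FiniteDimensional.span_of_finite ℚ (Set.finite_range xc)
  have hVn : Module.finrank ℚ V = n := by
    rw [hV, finrank_span_eq_card hx, Fintype.card_fin]
  have hVcn : Module.finrank ℚ Vc = n := by
    rw [hVc, finrank_span_eq_card hxc, Fintype.card_fin]
  -- `σ` swaps `V` and `Vc`
  have hσV : ∀ v ∈ V, conj v ∈ Vc := by
    intro v hv
    have h := Submodule.mem_map_of_mem (f := σ.toLinearMap) hv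
    rw [hV, Submodule.map_span, ← Set.range_comp] at h
    exact h
  have hσVc : ∀ v ∈ Vc, conj v ∈ V := by
    intro v hv
    have h := Submodule.mem_map_of_mem (f := σ.toLinearMap) hv
    rw [hVc, Submodule.map_span, ← Set.range_comp] at h
    have hcomp : (⇑σ.toLinearMap ∘ xc) = x := by
      funext j; simp [xc, σ_apply]
    rw [hcomp] at h
    exact h
  haveI : FiniteDimensional ℚ ↥(V ⊓ Vc) := Submodule.finiteDimensional_of_le inf_le_left
  have hcount : Module.finrank ℚ ↥(V ⊔ Vc) + Module.finrank ℚ ↥(V ⊓ Vc) = n + n := by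
    rw [Submodule.finrank_sup_add_finrank_inf_eq V Vc, hVn, hVcn]
  -- the symmetric family `y = (x, conj x)` spans `V ⊔ Vc` and is closed under `σ`
  let y : Fin n ⊕ Fin n → ℂ := Sum.elim x xc
  have hy_range : Set.range y = Set.range x ∪ Set.range xc := Set.Sum.elim_range x xc
  have hW : Submodule.span ℚ (Set.range y) = V ⊔ Vc := by
    rw [hy_range, Submodule.span_union]
  have hyσ : ∀ j, conj (y j) ∈ Submodule.span ℚ (Set.range y) := by
    rintro (j | j)
    · exact Submodule.subset_span ⟨Sum.inr j, rfl⟩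
    · have : conj (y (Sum.inr j)) = x j := by simp [y, xc]
      rw [this]
      exact Submodule.subset_span ⟨Sum.inl j, rfl⟩
  obtain ⟨p, w, hw_axis, hw_li, hw_mem, hw_rank⟩ := exists_axis_tuple_of_conj_stable _ y hyσ
  rw [hW] at hw_rank
  -- a basis `u` of `U = V ⊓ Vc`; `U` is `σ`-stable
  let bU := Module.finBasis ℚ ↥(V ⊓ Vc)
  let u : Fin (Module.finrank ℚ ↥(V ⊓ Vc)) → ℂ := fun i => (bU i : ℂ)
  have hu_span : Submodule.span ℚ (Set.range u) = V ⊓ Vc := by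
    have : Set.range u = (V ⊓ Vc).subtype '' Set.range bU := by
      rw [← Set.range_comp]; rfl
    rw [this, Submodule.span_image, bU.span_eq, Submodule.map_top, Submodule.range_subtype]
  have huσ : ∀ j, conj (u j) ∈ Submodule.span ℚ (Set.range u) := by
    intro j
    rw [hu_span]
    have hj : u j ∈ V ⊓ Vc := (bU j).2
    exact ⟨hσVc _ hj.2, hσV _ hj.1⟩
  obtain ⟨p', c, hc_axis, hc_li, hc_mem, hc_rank⟩ := exists_axis_tuple_of_conj_stable _ u huσ
  rw [hu_span] at hc_mem hc_rank
  -- clear denominators: scaled copies `w'`, `c'` whose exponentials lie in the right fields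
  choose Nw hNw hNw_mem using fun i =>
    Literature.NumberTheory.Transcendental.exists_nsmul_mem_span_int y (hw_mem i)
  choose N₁ hN₁ hN₁_mem using fun i =>
    Literature.NumberTheory.Transcendental.exists_nsmul_mem_span_int x (hc_mem i).1
  choose N₂ hN₂ hN₂_mem using fun i =>
    Literature.NumberTheory.Transcendental.exists_nsmul_mem_span_int xc (hc_mem i).2
  let w' : Fin p → ℂ := fun i => (Nw i : ℚ) • w i
  let c' : Fin p' → ℂ := fun i => ((N₁ i * N₂ i : ℕ) : ℚ) • c i
  have hw'li : LinearIndependent ℚ w' := by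
    let cw : Fin p → ℚˣ := fun i => Units.mk0 (Nw i : ℚ) (Nat.cast_ne_zero.mpr (hNw i))
    have he : cw • w = w' := by
      funext i; simp only [Pi.smul_apply', cw, w', Units.smul_def, Units.val_mk0]
    exact he ▸ hw_li.units_smul cw
  have hc'li : LinearIndependent ℚ c' := by
    let cc : Fin p' → ℚˣ := fun i => Units.mk0 ((N₁ i * N₂ i : ℕ) : ℚ)
      (Nat.cast_ne_zero.mpr (mul_ne_zero (hN₁ i) (hN₂ i)))
    have he : cc • c = c' := by
      funext i; simp only [Pi.smul_apply', cc, c', Units.smul_def, Units.val_mk0]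
    exact he ▸ hc_li.units_smul cc
  have hw'axis : ∀ i, (w' i).im = 0 ∨ (w' i).re = 0 := by
    intro i
    rcases hw_axis i with h | h
    · left; show ((Nw i : ℚ) • w i).im = 0
      rw [Rat.smul_def, Complex.mul_im]; simp [h]
    · right; show ((Nw i : ℚ) • w i).re = 0
      rw [Rat.smul_def, Complex.mul_re]; simp [h]
  have hc'axis : ∀ i, (c' i).im = 0 ∨ (c' i).re = 0 := by
    intro i
    rcases hc_axis i with h | h
    · left; show (((N₁ i * N₂ i : ℕ) : ℚ) • c i).im = 0
      rw [Rat.smul_def, Complex.mul_im]; simp [h]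
    · right; show (((N₁ i * N₂ i : ℕ) : ℚ) • c i).re = 0
      rw [Rat.smul_def, Complex.mul_re]; simp [h]
  have hc'_memx : ∀ i, c' i ∈ Submodule.span ℤ (Set.range x) := by
    intro i
    have : c' i = (N₂ i : ℤ) • ((N₁ i : ℚ) • c i) := by
      show ((N₁ i * N₂ i : ℕ) : ℚ) • c i = _
      rw [← Int.cast_smul_eq_zsmul ℚ, smul_smul]; push_cast; ring_nf
    rw [this]; exact Submodule.smul_mem _ _ (hN₁_mem i)
  have hc'_memxc : ∀ i, c' i ∈ Submodule.span ℤ (Set.range xc) := by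
    intro i
    have : c' i = (N₁ i : ℤ) • ((N₂ i : ℚ) • c i) := by
      show ((N₁ i * N₂ i : ℕ) : ℚ) • c i = _
      rw [← Int.cast_smul_eq_zsmul ℚ, smul_smul]; push_cast; ring_nf
    rw [this]; exact Submodule.smul_mem _ _ (hN₂_mem i)
  -- the fields
  set Sx : Set ℂ := Set.range x ∪ Set.range (cexp ∘ x) with hSx
  set Sxc : Set ℂ := Set.range xc ∪ Set.range (cexp ∘ xc) with hSxc
  set Fx : IntermediateField ℚ ℂ := IntermediateField.adjoin ℚ Sx with hFx
  set Fxc : IntermediateField ℚ ℂ := IntermediateField.adjoin ℚ Sxc with hFxc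
  set F : IntermediateField ℚ ℂ :=
    IntermediateField.adjoin ℚ (Set.range y ∪ Set.range (cexp ∘ y)) with hF
  set Fw : IntermediateField ℚ ℂ :=
    IntermediateField.adjoin ℚ (Set.range w' ∪ Set.range (cexp ∘ w')) with hFw
  set Fc : IntermediateField ℚ ℂ :=
    IntermediateField.adjoin ℚ (Set.range c' ∪ Set.range (cexp ∘ c')) with hFc
  -- the two axis counts
  have hp : (p : Cardinal) ≤ Algebra.trdeg ℚ Fw := hA p w' hw'axis hw'li
  have hp' : (p' : Cardinal) ≤ Algebra.trdeg ℚ Fc := hA p' c' hc'axis hc'li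
  -- inclusions of fields
  have hFwF : Fw ≤ F := by
    rw [hFw, IntermediateField.adjoin_le_iff]
    rintro a (⟨i, rfl⟩ | ⟨i, rfl⟩)
    · exact (Literature.NumberTheory.Transcendental.mem_adjoin_of_mem_span_int y (hNw_mem i)).1
    · exact (Literature.NumberTheory.Transcendental.mem_adjoin_of_mem_span_int y (hNw_mem i)).2
  have hFcFx : Fc ≤ Fx := by
    rw [hFc, IntermediateField.adjoin_le_iff]
    rintro a (⟨i, rfl⟩ | ⟨i, rfl⟩)
    · exact (Literature.NumberTheory.Transcendental.mem_adjoin_of_mem_span_int x (hc'_memx i)).1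
    · exact (Literature.NumberTheory.Transcendental.mem_adjoin_of_mem_span_int x (hc'_memx i)).2
  have hFcFxc : Fc ≤ Fxc := by
    rw [hFc, IntermediateField.adjoin_le_iff]
    rintro a (⟨i, rfl⟩ | ⟨i, rfl⟩)
    · exact (Literature.NumberTheory.Transcendental.mem_adjoin_of_mem_span_int xc (hc'_memxc i)).1
    · exact (Literature.NumberTheory.Transcendental.mem_adjoin_of_mem_span_int xc (hc'_memxc i)).2
  -- (a) `F = ℚ(Sxc ∪ Sx)`
  have hF_eq : F = IntermediateField.adjoin ℚ (Sxc ∪ Sx) := by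
    apply le_antisymm
    · rw [hF, IntermediateField.adjoin_le_iff]
      rintro a (⟨j | j, rfl⟩ | ⟨j | j, rfl⟩)
      · exact IntermediateField.subset_adjoin ℚ _ (Or.inr (Or.inl ⟨j, rfl⟩))
      · exact IntermediateField.subset_adjoin ℚ _ (Or.inl (Or.inl ⟨j, rfl⟩))
      · exact IntermediateField.subset_adjoin ℚ _ (Or.inr (Or.inr ⟨j, rfl⟩))
      · exact IntermediateField.subset_adjoin ℚ _ (Or.inl (Or.inr ⟨j, rfl⟩))
    · rw [IntermediateField.adjoin_le_iff]
      rintro a ((⟨j, rfl⟩ | ⟨j, rfl⟩) | (⟨j, rfl⟩ | ⟨j, rfl⟩))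
      · exact IntermediateField.subset_adjoin ℚ _ (Or.inl ⟨Sum.inr j, rfl⟩)
      · exact IntermediateField.subset_adjoin ℚ _ (Or.inr ⟨Sum.inr j, rfl⟩)
      · exact IntermediateField.subset_adjoin ℚ _ (Or.inl ⟨Sum.inl j, rfl⟩)
      · exact IntermediateField.subset_adjoin ℚ _ (Or.inr ⟨Sum.inl j, rfl⟩)
  -- (b) `σ` transports `Fx` onto `Fxc`: equal transcendence degrees
  have hconj : Algebra.trdeg ℚ Fxc = Algebra.trdeg ℚ Fx := by
    have hset : (⇑σ) '' Sx = Sxc := by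
      rw [hSx, hSxc, Set.image_union, ← Set.range_comp, ← Set.range_comp]
      have e1 : (⇑σ ∘ x) = xc := by funext j; simp [xc, σ_apply]
      have e2 : (⇑σ ∘ (cexp ∘ x)) = cexp ∘ xc := by
        funext j; simp [xc, σ_apply, Complex.exp_conj]
      rw [e1, e2]
    have hmap : Fx.map σ = Fxc := by rw [hFx, IntermediateField.adjoin_map, hset]
    exact (((IntermediateField.equivMap Fx σ).trans (IntermediateField.equivOfEq hmap)).trdeg_eq).symm
  -- (c) tower over `Fxc`: `trdeg ℚ(Sxc ∪ Sx) = trdeg Fxc + trdeg_{Fxc} Fxc(Sx)`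
  have htower1 : Algebra.trdeg ℚ Fxc + Algebra.trdeg Fxc (IntermediateField.adjoin Fxc Sx) =
      Algebra.trdeg ℚ (IntermediateField.adjoin ℚ (Sxc ∪ Sx)) := by
    exact tower (K := ℚ) Sxc Sx
  -- (d) base change `Fc ≤ Fxc` and the tower over `Fc`, whose top is `Fx`
  have hbase : Algebra.trdeg Fxc (IntermediateField.adjoin Fxc Sx) ≤
      Algebra.trdeg Fc (IntermediateField.adjoin Fc Sx) :=
    Literature.NumberTheory.Transcendental.trdeg_adjoin_le_of_le hFcFxc Sx
  have htower2 : Algebra.trdeg ℚ Fc + Algebra.trdeg Fc (IntermediateField.adjoin Fc Sx) =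
      Algebra.trdeg ℚ Fx := by
    have h3 : IntermediateField.adjoin ℚ ((Set.range c' ∪ Set.range (cexp ∘ c')) ∪ Sx) = Fx := by
      apply le_antisymm
      · rw [IntermediateField.adjoin_le_iff]
        rintro a (ha | ha)
        · exact hFcFx (IntermediateField.subset_adjoin ℚ _ ha)
        · exact IntermediateField.subset_adjoin ℚ _ ha
      · exact IntermediateField.adjoin.mono ℚ _ _ Set.subset_union_right
    have h12 := tower (K := ℚ) (Set.range c' ∪ Set.range (cexp ∘ c')) Sx
    rw [h3] at h12
    exact h12
  -- (e) assemble: 2n ≤ p + p' ≤ trdeg F + trdeg Fc ≤ trdeg Fxc + trdeg Fx = 2 trdeg Fx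
  have hnn : n + n ≤ p + p' := by
    have := hcount
    omega
  have hFwF' : Algebra.trdeg ℚ Fw ≤ Algebra.trdeg ℚ F :=
    trdeg_le_of_injective (IntermediateField.inclusion hFwF)
      (IntermediateField.inclusion_injective hFwF)
  have hsum : ((n + n : ℕ) : Cardinal) ≤ Algebra.trdeg ℚ Fx + Algebra.trdeg ℚ Fx := by
    calc ((n + n : ℕ) : Cardinal) ≤ ((p + p' : ℕ) : Cardinal) := by exact_mod_cast hnn
      _ = (p : Cardinal) + (p' : Cardinal) := by rw [Nat.cast_add]
      _ ≤ Algebra.trdeg ℚ Fw + Algebra.trdeg ℚ Fc := add_le_add hp hp'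
      _ ≤ Algebra.trdeg ℚ F + Algebra.trdeg ℚ Fc := add_le_add hFwF' (le_refl _)
      _ = (Algebra.trdeg ℚ Fxc + Algebra.trdeg Fxc (IntermediateField.adjoin Fxc Sx)) +
            Algebra.trdeg ℚ Fc := by rw [htower1, hF_eq]
      _ ≤ (Algebra.trdeg ℚ Fxc + Algebra.trdeg Fc (IntermediateField.adjoin Fc Sx)) +
            Algebra.trdeg ℚ Fc := add_le_add (add_le_add (le_refl _) hbase) (le_refl _)
      _ = Algebra.trdeg ℚ Fxc +
            (Algebra.trdeg ℚ Fc + Algebra.trdeg Fc (IntermediateField.adjoin Fc Sx)) := by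
          rw [add_assoc, add_comm (Algebra.trdeg Fc _) (Algebra.trdeg ℚ Fc)]
      _ = Algebra.trdeg ℚ Fx + Algebra.trdeg ℚ Fx := by rw [htower2, hconj]
  -- (f) halve
  rcases lt_or_ge (Algebra.trdeg ℚ Fx) Cardinal.aleph0 with hlt | hge
  · obtain ⟨m, hm⟩ := Cardinal.lt_aleph0.mp hlt
    rw [hm] at hsum ⊢
    norm_cast at hsum ⊢
    omega
  · exact (Cardinal.natCast_lt_aleph0 (n := n)).le.trans hge

/-- Item stmt-Schanuel-24788 (`AxisReduction`, support r9 of route-Schanuel-RootDecomp1C): Schanuel for axis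
tuples implies Schanuel. -/
theorem axisReduction_holds : AxisReduction := schanuel_of_axisSchanuel

end Summit.Schanuel.Schanuel.Theorems.RootDecomp1CAxisReduction
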